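import Literature.Barriers.CriticalPhenomena.HvdHRandomWalkTriangles
import HarnessLib

/-!
# Valid upper bounds for the SRW integrals `K_{n,l}(x)` of the NoBLE analysis

CITATION HEADER (PLACEMENT v2). This module is part of a certified REPRODUCTION of:
R. Fitzner, R. van der Hofstad, *Generalized approach to the non-backtracking lace expansion*,
Probab. Theory Related Fields 169 (2017) 1041–1119 [NoBLE17] (arXiv:1506.07969), §3.3.3 and §5.2,
as consumed by *Mean-field behavior for nearest-neighbor percolation in d > 10*, Electron. J.
Probab. 22 (2017) no. 43 [FvdH17]. Reproduces: the definitions (3.34)–(3.36) of the SRW integrals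
`D̂^{(x)}, I_{n,l}(x), K_{n,l}(x)` and `L_n(x)` ((5.7)), the recursion (5.1), and the printed bounds of
§5.2 on `K_{n,l}`: Cauchy–Schwarz (5.9), the `x = 0` rule (5.14) and the recursion (5.15). Origin: build `lace`,
unit `b2b-lace-tail` (the "K-bound repair", referee finding F8 / gap G11 of that build).

## What is proved, and why

[NoBLE17] bounds its weighted diagrams by the simple-random-walk integrals ((3.35), (3.36), p. 1071)

  `I_{n,l}(x) = ∫ D̂(k)^l Ĉ(k)ⁿ D̂^{(x)}(k) dk/(2π)^d`,
  `K_{n,l}(x) = ∫ |D̂(k)|^l Ĉ(k)ⁿ |D̂^{(x)}(k)| dk/(2π)^d`,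

over `(-π,π)^d`, where `Ĉ = Ĉ_{1/2d} = [1 - D̂]⁻¹` is the critical SRW two-point function and
`D̂^{(x)}(k) = (2^d d!)⁻¹ Σ_{ν ∈ 𝒫_d} Σ_{δ ∈ {±1}^d} e^{i k·p(x;ν,δ)}`, `p(x;ν,δ)_j = δ_j x_{ν_j}`
((3.34); "performing the sum over `δ` gives cosines, so that `D̂^{(x)}` is real" — we define it
with the cosines). Only `I_{n,l}` is computed; `K_{n,l}` must be BOUNDED in terms of it, and the
printed toolkit (§5.2, pp. 1091–1093; an adaptation of Hara–Slade 1992, App. B.1 (B.24)–(B.27)) is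

* (5.9)  `K_{n,l}(x) ≤ [I_{n,2l}(0) L_n(x)]^{1/2}`, `L_n(x) = ∫ Ĉⁿ (D̂^{(x)})²` ((5.7));
* (5.14) `K_{n,l}(0) = I_{n,l}(0)` (`l` even), `K_{n,l}(0) ≤ I_{n,l-1}(0)^{1/2} I_{n,l+1}(0)^{1/2}`
  (`l` odd);
* (5.15) `Ĉⁿ = Ĉⁿ⁻¹ + D̂ Ĉⁿ⁻¹ + D̂² Ĉⁿ`, whence `K_{n,l}(x) ≤ K_{n-1,l}(x) + K_{n-1,l+1}(x) + K_{n,l+2}(x)`.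

The accompanying notebook `SRW.nb` evaluates, at `x = e₁` and EVEN `l`, the cell
`Min[…, Abs[Ivalue[n, l+1, {0}]]]`, i.e. it uses `|I_{n,l+1}(0)|` as if it bounded `K_{n,l}(e₁)`;
since `D̂^{(e₁)} = D̂` one has `K_{n,l}(e₁) = K_{n,l+1}(0)` (`srwK_single`), and for `l + 1` odd
(5.14) gives only the Cauchy–Schwarz value — `|I_{n,l+1}(0)|` is not an upper bound (it is `≈ 3.6×`
too small at `d = 11`, `(n,l) = (1,0)`). This file proves, kernel-checked and hypothesis-free
except for the integrability range `d ≥ 2n + 1`, the VALID replacements: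

* `srwI_succ_succ` : the recursion (5.1) `I_{n+1,m+1}(x) = I_{n+1,m}(x) - I_{n,m}(x)`;
* `srwK_anti` : `l ≤ l' → K_{n,l'}(x) ≤ K_{n,l}(x)` (monotonisation in `l`, from `|D̂| ≤ 1`);
* `DhatSym_single`, `srwK_single` : `D̂^{(e_i)} = D̂`, `K_{n,l}(e_i) = K_{n,l+1}(0)`;
* `srwK_zero_even` : `K_{n,2j}(0) = I_{n,2j}(0)`;  `srwK_zero_odd_le` : (5.14), odd case;
* `srwK_le_sqrt_srwI_mul_srwL` : (5.9);  `srwK_le_three_terms` : the consequence of (5.15);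
* `srwK_zero_le_of_majorant` : for ANY real polynomial `P(t) = Σ_{j ≤ N} p_j t^j` with
  `|t|^m ≤ P(t)` on `[-1,1]`, `K_{n,m}(0) ≤ Σ_j p_j I_{n,j}(0)` — positivity of the measure
  `Ĉⁿ dk`; (5.14)-odd is the case `P(t) = (λ t^{m-1} + λ⁻¹ t^{m+1})/2`. This is the lever by
  which sharper valid bounds are certified from the computed moments `I_{n,j}(0)` alone;
* packaged at `x = e_i`: `srwK_single_odd` (`l` odd: `K_{n,l}(e_i) = I_{n,l+1}(0)`),
  `srwK_single_even_le` (`l` even: `K_{n,l}(e_i) ≤ [I_{n,l}(0) I_{n,l+2}(0)]^{1/2}`),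
  `srwK_single_le_of_majorant`.

Integrability (`d ≥ 2n + 1`) is the tree's `integrable_Chat_pow` (Heydenreich–van der Hofstad
2017, Prop. 5.5, file `HvdHRandomWalkTriangles.lean`); the integrals are Bochner integrals against
`Slade2006Prop53.P d` (Lebesgue measure on the closed cube `[-π,π]^d`, which differs from the
printed open cube by a null set), divided by `(2π)^d`.

## References

* [NoBLE17] R. Fitzner, R. van der Hofstad, PTRF 169 (2017) 1041–1119: Def. 2.5 (total rotational
  symmetry, `p(x;ν,δ)`) p. 1058; (3.34)–(3.36) p. 1071; (5.1) p. 1090; §5.2 (5.7), (5.9), (5.14)–(5.16)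
  pp. 1091–1093 (bib key `FitznerVanDerHofstad2016NoBLE`).
* [HS92b] T. Hara, G. Slade, *The lace expansion for self-avoiding walk in five or more
  dimensions*, Rev. Math. Phys. 4 (1992) 235–327, App. B.1, (B.24)–(B.27) (`HaraSlade1992b`).
* M. Heydenreich, R. van der Hofstad, *Progress in High-Dimensional Percolation and Random Graphs*
  (Springer 2017), Prop. 5.5 (`HeydenreichVanDerHofstad2017`).
-/

noncomputable section

open MeasureTheory Real Finset
open scoped BigOperators

namespace Literature.Probability.FitznerVanDerHofstad2017

open Literature.Barriers.CriticalPhenomena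
open Literature.Barriers.CriticalPhenomena.Slade2006Prop53 (P)

variable {d : ℕ}

/-! ### The symmetrised exponential `D̂^{(x)}(k)` ((3.34)) -/

/-- `D̂^{(x)}(k) = (2^d d!)⁻¹ Σ_{ν ∈ 𝒫_d} Σ_{δ ∈ {-1,1}^d} e^{i k·p(x;ν,δ)}` with
`p(x;ν,δ)_j = δ_j x_{ν_j}` (Def. 2.5); the sum over `δ` is real, so we write the summands as
`cos(k·p(x;ν,δ)) = cos(Σ_j δ_j x_{ν_j} k_j)`.
[cite: FitznerVanDerHofstad2016NoBLE, (3.34) p. 1071; Def. 2.5 p. 1058] -/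
def DhatSym (d : ℕ) (x : Fin d → ℤ) (k : Fin d → ℝ) : ℝ :=
  (∑ ν : Equiv.Perm (Fin d), ∑ δ : Fin d → ℤˣ,
      Real.cos (∑ j, (((δ j : ℤ) : ℝ) * (x (ν j) : ℝ)) * k j)) / (2 ^ d * (d.factorial : ℝ))

/-- Unfolding lemma for `DhatSym`. [cite: FitznerVanDerHofstad2016NoBLE, (3.34) p. 1071] -/
theorem DhatSym_def (x : Fin d → ℤ) (k : Fin d → ℝ) :
    DhatSym d x k = (∑ ν : Equiv.Perm (Fin d), ∑ δ : Fin d → ℤˣ,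
      Real.cos (∑ j, (((δ j : ℤ) : ℝ) * (x (ν j) : ℝ)) * k j)) / (2 ^ d * (d.factorial : ℝ)) :=
  rfl

/-- `#𝒫_d = d!`. [folklore] -/
theorem card_perm_fin (d : ℕ) : Fintype.card (Equiv.Perm (Fin d)) = d.factorial := by
  rw [Fintype.card_perm, Fintype.card_fin]

/-- `#{-1,1}^d = 2^d`. [folklore] -/
theorem card_signs (d : ℕ) : Fintype.card (Fin d → ℤˣ) = 2 ^ d := by
  classical
  rw [Fintype.card_fun, Fintype.card_units_int, Fintype.card_fin]

/-- The normalisation `2^d d!` is positive. [folklore] -/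
theorem two_pow_mul_factorial_pos (d : ℕ) : (0 : ℝ) < 2 ^ d * (d.factorial : ℝ) := by
  have := Nat.factorial_pos d
  positivity

/-- `|D̂^{(x)}(k)| ≤ 1` (an average of cosines).
[cite: FitznerVanDerHofstad2016NoBLE, (3.34) p. 1071] -/
theorem abs_DhatSym_le_one (x : Fin d → ℤ) (k : Fin d → ℝ) : |DhatSym d x k| ≤ 1 := by
  classical
  rw [DhatSym, abs_div, abs_of_pos (two_pow_mul_factorial_pos d),
    div_le_one (two_pow_mul_factorial_pos d)]
  calc |∑ ν : Equiv.Perm (Fin d), ∑ δ : Fin d → ℤˣ,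
          Real.cos (∑ j, (((δ j : ℤ) : ℝ) * (x (ν j) : ℝ)) * k j)|
      ≤ ∑ ν : Equiv.Perm (Fin d), |∑ δ : Fin d → ℤˣ,
          Real.cos (∑ j, (((δ j : ℤ) : ℝ) * (x (ν j) : ℝ)) * k j)| :=
        Finset.abs_sum_le_sum_abs _ _
    _ ≤ ∑ ν : Equiv.Perm (Fin d), ∑ δ : Fin d → ℤˣ,
          |Real.cos (∑ j, (((δ j : ℤ) : ℝ) * (x (ν j) : ℝ)) * k j)| :=
        Finset.sum_le_sum fun ν _ => Finset.abs_sum_le_sum_abs _ _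
    _ ≤ ∑ _ν : Equiv.Perm (Fin d), ∑ _δ : Fin d → ℤˣ, (1 : ℝ) :=
        Finset.sum_le_sum fun ν _ => Finset.sum_le_sum fun δ _ => abs_cos_le_one _
    _ = 2 ^ d * (d.factorial : ℝ) := by
        simp only [Finset.sum_const, Finset.card_univ, card_perm_fin, card_signs]
        ring

/-- `D̂^{(x)}` is continuous in `k`. [folklore] -/
theorem continuous_DhatSym (d : ℕ) (x : Fin d → ℤ) : Continuous (DhatSym d x) := by
  unfold DhatSym
  fun_prop

/-- `D̂^{(x)}` is measurable in `k`. [folklore] -/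
theorem measurable_DhatSym (d : ℕ) (x : Fin d → ℤ) : Measurable (DhatSym d x) :=
  (continuous_DhatSym d x).measurable

/-- `D̂^{(0)} ≡ 1`. [cite: FitznerVanDerHofstad2016NoBLE, §5.2 ("we use D̂^{(0)}(k) = 1") p. 1092] -/
theorem DhatSym_zero (k : Fin d → ℝ) : DhatSym d 0 k = 1 := by
  classical
  rw [DhatSym, div_eq_one_iff_eq (two_pow_mul_factorial_pos d).ne']
  simp only [Pi.zero_apply, Int.cast_zero, mul_zero, zero_mul, Finset.sum_const_zero,
    Real.cos_zero, Finset.sum_const, Finset.card_univ, card_perm_fin, card_signs]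
  ring

/-- Averaging over the permutation group: `Σ_{ν ∈ 𝒫_d} f(ν i) = (d-1)! Σ_j f j`. [folklore] -/
theorem sum_perm_apply (f : Fin d → ℝ) (i : Fin d) :
    ∑ ν : Equiv.Perm (Fin d), f (ν i) = ((d - 1).factorial : ℝ) * ∑ j, f j := by
  classical
  -- `A i' := Σ_ν f(ν i')` does not depend on `i'`
  have hA : ∀ i' : Fin d, ∑ ν : Equiv.Perm (Fin d), f (ν i') =
      ∑ ν : Equiv.Perm (Fin d), f (ν i) := by
    intro i'
    have h := Equiv.sum_comp (Equiv.mulRight (Equiv.swap i i'))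
      (fun μ : Equiv.Perm (Fin d) => f (μ i))
    -- h : Σ_ν f ((ν * swap i i') i) = Σ_μ f (μ i)
    rw [← h]
    refine Finset.sum_congr rfl fun ν _ => ?_
    simp [Equiv.Perm.mul_apply, Equiv.swap_apply_left]
  have hd : d ≠ 0 := by
    intro h; subst h; exact Fin.elim0 i
  -- sum over `i'`
  have hsum : ∑ i' : Fin d, ∑ ν : Equiv.Perm (Fin d), f (ν i') =
      (d.factorial : ℝ) * ∑ j, f j := by
    rw [Finset.sum_comm]
    have : ∀ ν : Equiv.Perm (Fin d), ∑ i' : Fin d, f (ν i') = ∑ j, f j :=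
      fun ν => Equiv.sum_comp ν f
    simp only [this, Finset.sum_const, Finset.card_univ, card_perm_fin, nsmul_eq_mul]
  have hsum' : ∑ i' : Fin d, ∑ ν : Equiv.Perm (Fin d), f (ν i') =
      (d : ℝ) * ∑ ν : Equiv.Perm (Fin d), f (ν i) := by
    simp only [hA, Finset.sum_const, Finset.card_univ, Fintype.card_fin, nsmul_eq_mul]
  have hfac : (d.factorial : ℝ) = d * ((d - 1).factorial : ℝ) := by
    rw [← Nat.mul_factorial_pred hd]; push_cast; ring
  have hdR : (d : ℝ) ≠ 0 := Nat.cast_ne_zero.2 hd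
  have := hsum'.symm.trans hsum
  rw [hfac, mul_assoc] at this
  exact mul_left_cancel₀ hdR this

/-- **`D̂^{(e_i)} = D̂`**: for a unit vector the signed-permutation average of `e^{ik·p(e_i;ν,δ)}`
is `d⁻¹ Σ_μ cos k_μ`. Hence every SRW integral "at `x = e₁`" is the corresponding integral at
`x = 0` with one more power of `|D̂|` (`srwK_single`).
[cite: FitznerVanDerHofstad2016NoBLE, (3.34) p. 1071] -/
theorem DhatSym_single (i : Fin d) (k : Fin d → ℝ) :
    DhatSym d (Pi.single i 1) k = Dhat d k := by
  classical
  have hd : d ≠ 0 := by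
    intro h; subst h; exact Fin.elim0 i
  -- the phase `k·p(e_i;ν,δ) = δ_{j₀} k_{j₀}`, `j₀ = ν⁻¹ i`, and `cos` is even
  have hinner : ∀ (ν : Equiv.Perm (Fin d)) (δ : Fin d → ℤˣ),
      Real.cos (∑ j, (((δ j : ℤ) : ℝ) * ((Pi.single i (1 : ℤ) : Fin d → ℤ) (ν j) : ℝ)) * k j)
        = Real.cos (k (ν.symm i)) := by
    intro ν δ
    rw [Finset.sum_eq_single (ν.symm i)]
    · have hνj : ν (ν.symm i) = i := Equiv.apply_symm_apply ν i
      rw [hνj, Pi.single_eq_same]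
      rcases Int.units_eq_one_or (δ (ν.symm i)) with h | h
      · simp [h]
      · simp [h, Real.cos_neg]
    · intro j _ hj
      have : ν j ≠ i := fun h => hj (by rw [← h, Equiv.symm_apply_apply])
      rw [Pi.single_eq_of_ne this]
      simp
    · intro h; exact absurd (Finset.mem_univ _) h
  simp_rw [DhatSym, hinner, Finset.sum_const, Finset.card_univ, card_signs]
  -- `Σ_ν cos k_{ν⁻¹ i} = Σ_ν cos k_{ν i} = (d-1)! Σ_j cos k_j`
  have hinv : ∑ ν : Equiv.Perm (Fin d), (2 ^ d) • Real.cos (k (ν.symm i)) =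
      ∑ ν : Equiv.Perm (Fin d), (2 ^ d) • Real.cos (k (ν i)) := by
    have h := Equiv.sum_comp (Equiv.inv (Equiv.Perm (Fin d)))
      (fun ν : Equiv.Perm (Fin d) => (2 ^ d) • Real.cos (k (ν i)))
    rw [← h]
    refine Finset.sum_congr rfl fun ν _ => ?_
    simp [Equiv.Perm.inv_def]
  rw [hinv, ← Finset.smul_sum, sum_perm_apply (fun j => Real.cos (k j)) i, Dhat_def,
    nsmul_eq_mul]
  have hfac : (d.factorial : ℝ) = d * ((d - 1).factorial : ℝ) := by
    rw [← Nat.mul_factorial_pred hd]; push_cast; ring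
  have hdR : (d : ℝ) ≠ 0 := Nat.cast_ne_zero.2 hd
  have hf : ((d - 1).factorial : ℝ) ≠ 0 := by positivity
  rw [hfac]
  push_cast
  field_simp

/-! ### The SRW integrals ((3.35), (3.36), (5.7)), normalised by `(2π)^d` -/

/-- `I_{n,l}(x) = ∫_{[-π,π]^d} D̂(k)^l Ĉ(k)ⁿ D̂^{(x)}(k) dk/(2π)^d`, `Ĉ = [1 - D̂]⁻¹ = Chat d 1`
(a Bochner integral: meaningful for `d ≥ 2n + 1`, where the integrand is integrable).
[cite: FitznerVanDerHofstad2016NoBLE, (3.35) p. 1071] -/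
def srwI (d n l : ℕ) (x : Fin d → ℤ) : ℝ :=
  (∫ k, (Dhat d k ^ l * DhatSym d x k) * Chat d 1 k ^ n ∂P d) / (2 * π) ^ d

/-- `K_{n,l}(x) = ∫_{[-π,π]^d} |D̂(k)|^l Ĉ(k)ⁿ |D̂^{(x)}(k)| dk/(2π)^d`.
[cite: FitznerVanDerHofstad2016NoBLE, (3.36) p. 1071] -/
def srwK (d n l : ℕ) (x : Fin d → ℤ) : ℝ :=
  (∫ k, (|Dhat d k| ^ l * |DhatSym d x k|) * Chat d 1 k ^ n ∂P d) / (2 * π) ^ d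

/-- `L_n(x) = ∫_{[-π,π]^d} Ĉ(k)ⁿ D̂^{(x)}(k)² dk/(2π)^d`.
[cite: FitznerVanDerHofstad2016NoBLE, (5.7) p. 1091] -/
def srwL (d n : ℕ) (x : Fin d → ℤ) : ℝ :=
  (∫ k, DhatSym d x k ^ 2 * Chat d 1 k ^ n ∂P d) / (2 * π) ^ d

/-- The normalisation `(2π)^d` is positive. [folklore] -/
theorem two_pi_pow_pos (d : ℕ) : (0 : ℝ) < (2 * π) ^ d := by positivity

/-- `Ĉ = Ĉ₁ ≥ 0`. [folklore] -/
theorem Chat_one_nonneg (k : Fin d → ℝ) : 0 ≤ Chat d 1 k := by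
  -- (self-contained: the root-level `Chat_nonneg` of `HvdHRandomWalkTriangles.lean` clashes by name with
  -- `GaussianDominationRouteRandomWalk.lean` and is being retired from the root namespace, REFEREE-2 R14)
  rw [Chat]
  exact div_nonneg zero_le_one (by nlinarith [Dhat_le_one k])

/-- Integrability of `w · Ĉⁿ` on the cube for a measurable weight `|w| ≤ 1`, `d ≥ 2n + 1`
(from the tree's `integrable_Chat_pow`, Heydenreich–van der Hofstad Prop. 5.5).
[cite: HeydenreichVanDerHofstad2017, Prop. 5.5] -/
theorem integrable_weight_mul_Chat_pow {n : ℕ} (hd : 2 * n + 1 ≤ d) {w : (Fin d → ℝ) → ℝ}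
    (hw : Measurable w) (hw1 : ∀ k, |w k| ≤ 1) :
    Integrable (fun k => w k * Chat d 1 k ^ n) (P d) :=
  (integrable_Chat_pow n hd zero_le_one le_rfl).bdd_mul hw.aestronglyMeasurable
    (ae_of_all _ fun k => by rw [Real.norm_eq_abs]; exact hw1 k)

/-- `|D̂|^l ≤ 1`. [folklore] -/
theorem abs_Dhat_pow_le_one (l : ℕ) (k : Fin d → ℝ) : |Dhat d k| ^ l ≤ 1 :=
  pow_le_one₀ (abs_nonneg _) (abs_Dhat_le_one k)

/-- The `K`-integrand is integrable for `d ≥ 2n + 1`. [folklore] -/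
theorem integrable_srwK_integrand {n : ℕ} (hd : 2 * n + 1 ≤ d) (l : ℕ) (x : Fin d → ℤ) :
    Integrable (fun k => (|Dhat d k| ^ l * |DhatSym d x k|) * Chat d 1 k ^ n) (P d) := by
  refine integrable_weight_mul_Chat_pow hd
    (((continuous_Dhat d).measurable.abs.pow_const l).mul (measurable_DhatSym d x).abs) fun k => ?_
  rw [abs_mul, abs_abs, abs_of_nonneg (pow_nonneg (abs_nonneg _) l)]
  exact mul_le_one₀ (abs_Dhat_pow_le_one l k) (abs_nonneg _) (abs_DhatSym_le_one x k)

/-- The `I`-integrand is integrable for `d ≥ 2n + 1`. [folklore] -/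
theorem integrable_srwI_integrand {n : ℕ} (hd : 2 * n + 1 ≤ d) (l : ℕ) (x : Fin d → ℤ) :
    Integrable (fun k => (Dhat d k ^ l * DhatSym d x k) * Chat d 1 k ^ n) (P d) := by
  refine integrable_weight_mul_Chat_pow hd
    (((continuous_Dhat d).measurable.pow_const l).mul (measurable_DhatSym d x)) fun k => ?_
  rw [abs_mul, abs_pow]
  exact mul_le_one₀ (abs_Dhat_pow_le_one l k) (abs_nonneg _) (abs_DhatSym_le_one x k)

/-- The `L`-integrand is integrable for `d ≥ 2n + 1`. [folklore] -/
theorem integrable_srwL_integrand {n : ℕ} (hd : 2 * n + 1 ≤ d) (x : Fin d → ℤ) :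
    Integrable (fun k => DhatSym d x k ^ 2 * Chat d 1 k ^ n) (P d) := by
  refine integrable_weight_mul_Chat_pow hd ((measurable_DhatSym d x).pow_const 2) fun k => ?_
  rw [abs_pow, ← sq_abs, pow_two] at *
  rw [abs_abs]
  exact mul_le_one₀ (abs_DhatSym_le_one x k) (abs_nonneg _) (abs_DhatSym_le_one x k)

/-- `K_{n,l}(x) ≥ 0`. [folklore] -/
theorem srwK_nonneg (n l : ℕ) (x : Fin d → ℤ) : 0 ≤ srwK d n l x :=
  div_nonneg (integral_nonneg fun k => mul_nonneg
    (mul_nonneg (pow_nonneg (abs_nonneg _) l) (abs_nonneg _)) (pow_nonneg (Chat_one_nonneg k) n))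
    (two_pi_pow_pos d).le

/-- `L_n(x) ≥ 0`. [folklore] -/
theorem srwL_nonneg (n : ℕ) (x : Fin d → ℤ) : 0 ≤ srwL d n x :=
  div_nonneg (integral_nonneg fun k => mul_nonneg (sq_nonneg _) (pow_nonneg (Chat_one_nonneg k) n))
    (two_pi_pow_pos d).le

/-- `I_{n,2j}(0) ≥ 0`. [folklore] -/
theorem srwI_zero_even_nonneg (n j : ℕ) : 0 ≤ srwI d n (2 * j) 0 :=
  div_nonneg (integral_nonneg fun k => mul_nonneg
    (mul_nonneg (by rw [pow_mul]; exact pow_nonneg (sq_nonneg _) j) (by rw [DhatSym_zero]; norm_num))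
    (pow_nonneg (Chat_one_nonneg k) n)) (two_pi_pow_pos d).le

/-! ### The recursion (5.1) -/

/-- Off the null set `{k = 0}` of the cube, `1 - D̂(k) > 0`, hence `Ĉ(k)[1 - D̂(k)] = 1` almost
everywhere (`d ≥ 1`). [folklore] -/
theorem ae_Chat_mul_one_sub_Dhat (hd : 1 ≤ d) : ∀ᵐ k ∂P d, Chat d 1 k * (1 - Dhat d k) = 1 := by
  haveI : Nonempty (Fin d) := ⟨⟨0, hd⟩⟩
  haveI : NullSingletonClass Slade2006Prop53.μI := by
    unfold Slade2006Prop53.μI; infer_instance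
  haveI : NullSingletonClass (P d) := by unfold Slade2006Prop53.P; infer_instance
  have h0 : ∀ᵐ k ∂P d, k ≠ 0 := Measure.ae_ne _ _
  have hcube : ∀ᵐ k ∂P d, k ∈ Set.pi Set.univ fun _ : Fin d => Set.Icc (-π) π := by
    rw [← Slade2006Prop53.volume_restrict_cube]
    exact ae_restrict_mem (MeasurableSet.univ_pi fun _ => measurableSet_Icc)
  filter_upwards [h0, hcube] with k hk0 hkc
  have hX := one_sub_Dhat_pos hd (fun j => hkc j (Set.mem_univ j)) hk0
  rw [Chat, one_mul]
  field_simp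

/-- **(5.1)**: `I_{n+1,m+1}(x) = I_{n+1,m}(x) - I_{n,m}(x)` (`d ≥ 2n + 3`), obtained by writing
`D̂ = 1 - [1 - D̂]`; this reduces every `I_{n,m}` to the `I_{n,0}` (Bessel integrals) and the
`I_{0,m}` (walk counts `p_m(x)/(2d)^m`).
[cite: FitznerVanDerHofstad2016NoBLE, (5.1) p. 1090] -/
theorem srwI_succ_succ {n : ℕ} (hd : 2 * (n + 1) + 1 ≤ d) (m : ℕ) (x : Fin d → ℤ) :
    srwI d (n + 1) (m + 1) x = srwI d (n + 1) m x - srwI d n m x := by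
  have hd' : 2 * n + 1 ≤ d := by omega
  have hA := integrable_srwI_integrand hd m x
  have hB := integrable_srwI_integrand hd' m x
  unfold srwI
  rw [← sub_div, ← integral_sub hA hB]
  congr 1
  refine integral_congr_ae ?_
  filter_upwards [ae_Chat_mul_one_sub_Dhat (d := d) (by omega)] with k hk
  linear_combination (-(Dhat d k ^ m * DhatSym d x k * Chat d 1 k ^ n)) * hk

/-! ### Monotonisation in `l` and the `x = e_i ↔ x = 0` identity -/

/-- **Monotonisation**: `K_{n,l'}(x) ≤ K_{n,l}(x)` for `l ≤ l'` (`|D̂| ≤ 1`; `d ≥ 2n + 1`).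
Not printed in [NoBLE17]; it is what makes a bound computed for a smaller `l` usable for a larger
one. [folklore] -/
theorem srwK_anti {n : ℕ} (hd : 2 * n + 1 ≤ d) (x : Fin d → ℤ) {l l' : ℕ} (h : l ≤ l') :
    srwK d n l' x ≤ srwK d n l x := by
  unfold srwK
  refine div_le_div_of_nonneg_right ?_ (two_pi_pow_pos d).le
  refine integral_mono_of_nonneg (ae_of_all _ fun k => ?_) (integrable_srwK_integrand hd l x)
    (ae_of_all _ fun k => ?_)
  · exact mul_nonneg (mul_nonneg (pow_nonneg (abs_nonneg _) l') (abs_nonneg _))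
      (pow_nonneg (Chat_one_nonneg k) n)
  · have h1 : |Dhat d k| ^ l' ≤ |Dhat d k| ^ l :=
      pow_le_pow_of_le_one (abs_nonneg _) (abs_Dhat_le_one k) h
    exact mul_le_mul_of_nonneg_right (mul_le_mul_of_nonneg_right h1 (abs_nonneg _))
      (pow_nonneg (Chat_one_nonneg k) n)

/-- In particular `K_{n,l+1}(x) ≤ K_{n,l}(x)`. [folklore] -/
theorem srwK_succ_le {n : ℕ} (hd : 2 * n + 1 ≤ d) (l : ℕ) (x : Fin d → ℤ) :
    srwK d n (l + 1) x ≤ srwK d n l x :=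
  srwK_anti hd x (Nat.le_succ l)

/-- **`K_{n,l}(e_i) = K_{n,l+1}(0)`** (no dimension hypothesis: an identity of integrands).
[cite: FitznerVanDerHofstad2016NoBLE, (3.34), (3.36) p. 1071] -/
theorem srwK_single (n l : ℕ) (i : Fin d) :
    srwK d n l (Pi.single i 1) = srwK d n (l + 1) 0 := by
  unfold srwK
  congr 1
  refine integral_congr_ae (ae_of_all _ fun k => ?_)
  simp only [DhatSym_single, DhatSym_zero, abs_one, mul_one, pow_succ]

/-- `I_{n,l}(e_i) = I_{n,l+1}(0)`. [cite: FitznerVanDerHofstad2016NoBLE, (3.34), (3.35) p. 1071] -/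
theorem srwI_single (n l : ℕ) (i : Fin d) :
    srwI d n l (Pi.single i 1) = srwI d n (l + 1) 0 := by
  unfold srwI
  congr 1
  refine integral_congr_ae (ae_of_all _ fun k => ?_)
  simp only [DhatSym_single, DhatSym_zero, mul_one, pow_succ]

/-- `L_n(0) = I_{n,0}(0)`. [folklore] -/
theorem srwL_zero (n : ℕ) : srwL d n 0 = srwI d n 0 0 := by
  unfold srwL srwI
  congr 1
  refine integral_congr_ae (ae_of_all _ fun k => ?_)
  simp only [DhatSym_zero, one_pow, one_mul, pow_zero]

/-! ### The `x = 0` rule (5.14) -/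

/-- (5.14), even case: `K_{n,2j}(0) = I_{n,2j}(0)`.
[cite: FitznerVanDerHofstad2016NoBLE, (5.14) p. 1092] -/
theorem srwK_zero_even (n j : ℕ) : srwK d n (2 * j) 0 = srwI d n (2 * j) 0 := by
  unfold srwK srwI
  congr 1
  refine integral_congr_ae (ae_of_all _ fun k => ?_)
  simp only [DhatSym_zero, abs_one, mul_one, pow_mul, sq_abs]

/-- Optimising `λ` in `K ≤ (λA + B/λ)/2`: the Cauchy–Schwarz value `√A √B`. [folklore] -/
theorem le_sqrt_mul_sqrt_of_forall {K A B : ℝ} (hA : 0 ≤ A) (hB : 0 ≤ B)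
    (h : ∀ lam : ℝ, 0 < lam → K ≤ (lam * A + B / lam) / 2) : K ≤ Real.sqrt A * Real.sqrt B := by
  rcases hA.eq_or_lt with hA0 | hApos
  · -- A = 0: K ≤ B/(2λ) for all λ > 0, hence K ≤ 0
    subst hA0
    rw [Real.sqrt_zero, zero_mul]
    by_contra hK'
    have hK : 0 < K := lt_of_not_ge hK'
    have h1 := h ((B + 1) / K) (div_pos (by linarith) hK)
    have : (B + 1) / K * 0 + B / ((B + 1) / K) = B * K / (B + 1) := by
      field_simp
      ring
    rw [this] at h1
    have h2 : B * K / (B + 1) < K * 2 := by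
      rw [div_lt_iff₀ (by linarith)]; nlinarith
    linarith
  rcases hB.eq_or_lt with hB0 | hBpos
  · subst hB0
    rw [Real.sqrt_zero, mul_zero]
    by_contra hK'
    have hK : 0 < K := lt_of_not_ge hK'
    have h1 := h (K / A) (div_pos hK hApos)
    have : (K / A * A + 0 / (K / A)) / 2 = K / 2 := by
      field_simp
      ring
    rw [this] at h1
    linarith
  · have hl : 0 < Real.sqrt B / Real.sqrt A :=
      div_pos (Real.sqrt_pos.2 hBpos) (Real.sqrt_pos.2 hApos)
    have h1 := h _ hl
    have e1 : Real.sqrt B / Real.sqrt A * A = Real.sqrt B * Real.sqrt A := by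
      rw [div_mul_eq_mul_div, mul_div_assoc, Real.div_sqrt]
    have e2 : B / (Real.sqrt B / Real.sqrt A) = Real.sqrt A * Real.sqrt B := by
      rw [div_div_eq_mul_div, mul_comm B, mul_div_assoc, Real.div_sqrt]
    rw [e1, e2] at h1
    linarith

/-- AM–GM for the integrands: `2|a||b| ≤ λ a² + b²/λ` (`λ > 0`). [folklore] -/
theorem abs_mul_abs_le_am_gm (a b : ℝ) {lam : ℝ} (hl : 0 < lam) :
    |a| * |b| ≤ (lam * a ^ 2 + b ^ 2 / lam) / 2 := by
  have h : 0 ≤ (lam * |a| - |b|) ^ 2 / lam := div_nonneg (sq_nonneg _) hl.le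
  have e : (lam * |a| - |b|) ^ 2 / lam = lam * a ^ 2 + b ^ 2 / lam - 2 * (|a| * |b|) := by
    rw [← sq_abs a, ← sq_abs b]
    field_simp
    ring
  linarith [e ▸ h]

/-- **Polynomial majorant lemma** (the certification lever): if `|t|^m ≤ Σ_{j ≤ N} p_j t^j` for all
`t ∈ [-1,1]`, then, by positivity of `Ĉⁿ dk`, `K_{n,m}(0) ≤ Σ_{j ≤ N} p_j I_{n,j}(0)` (`d ≥ 2n+1`).
(5.14)-odd / [HS92b] (B.24) is the majorant `(λ t^{m-1} + λ⁻¹ t^{m+1})/2`; any majorising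
polynomial gives a valid bound from the computed moments `I_{n,j}(0)`. [folklore] -/
theorem srwK_zero_le_of_majorant {n : ℕ} (hd : 2 * n + 1 ≤ d) (m N : ℕ) (p : ℕ → ℝ)
    (hP : ∀ t ∈ Set.Icc (-1 : ℝ) 1, |t| ^ m ≤ ∑ j ∈ Finset.range (N + 1), p j * t ^ j) :
    srwK d n m 0 ≤ ∑ j ∈ Finset.range (N + 1), p j * srwI d n j 0 := by
  have hI : ∀ j, Integrable (fun k => (Dhat d k ^ j * DhatSym d 0 k) * Chat d 1 k ^ n) (P d) :=
    fun j => integrable_srwI_integrand hd j 0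
  have hrhs : ∑ j ∈ Finset.range (N + 1), p j * srwI d n j 0 =
      (∫ k, ∑ j ∈ Finset.range (N + 1),
        p j * ((Dhat d k ^ j * DhatSym d 0 k) * Chat d 1 k ^ n) ∂P d) / (2 * π) ^ d := by
    rw [integral_finsetSum _ fun j _ => (hI j).const_mul (p j), Finset.sum_div]
    refine Finset.sum_congr rfl fun j _ => ?_
    rw [integral_const_mul, srwI, mul_div_assoc]
  rw [hrhs, srwK]
  refine div_le_div_of_nonneg_right ?_ (two_pi_pow_pos d).le
  refine integral_mono_of_nonneg (ae_of_all _ fun k => ?_)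
    (integrable_finsetSum _ fun j _ => (hI j).const_mul (p j)) (ae_of_all _ fun k => ?_)
  · exact mul_nonneg (mul_nonneg (pow_nonneg (abs_nonneg _) m) (abs_nonneg _))
      (pow_nonneg (Chat_one_nonneg k) n)
  · have ht : Dhat d k ∈ Set.Icc (-1 : ℝ) 1 := abs_le.1 (abs_Dhat_le_one k)
    have hmaj := hP _ ht
    have hC := pow_nonneg (Chat_one_nonneg k) n
    have e : ∑ j ∈ Finset.range (N + 1), p j * ((Dhat d k ^ j * DhatSym d 0 k) * Chat d 1 k ^ n)
        = (∑ j ∈ Finset.range (N + 1), p j * Dhat d k ^ j) * Chat d 1 k ^ n := by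
      rw [Finset.sum_mul]
      refine Finset.sum_congr rfl fun j _ => ?_
      rw [DhatSym_zero]; ring
    show (|Dhat d k| ^ m * |DhatSym d 0 k|) * Chat d 1 k ^ n ≤
      ∑ j ∈ Finset.range (N + 1), p j * ((Dhat d k ^ j * DhatSym d 0 k) * Chat d 1 k ^ n)
    rw [e, DhatSym_zero, abs_one, mul_one]
    exact mul_le_mul_of_nonneg_right hmaj hC

/-- (5.14), odd case / [HS92b] (B.24): `K_{n,2j+1}(0) ≤ I_{n,2j}(0)^{1/2} I_{n,2j+2}(0)^{1/2}`
(`d ≥ 2n + 1`). [cite: FitznerVanDerHofstad2016NoBLE, (5.14) p. 1092] -/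
theorem srwK_zero_odd_le {n : ℕ} (hd : 2 * n + 1 ≤ d) (j : ℕ) :
    srwK d n (2 * j + 1) 0 ≤ Real.sqrt (srwI d n (2 * j) 0) * Real.sqrt (srwI d n (2 * j + 2) 0) := by
  have hB : 0 ≤ srwI d n (2 * j + 2) 0 := by
    have := srwI_zero_even_nonneg (d := d) n (j + 1)
    rwa [show 2 * (j + 1) = 2 * j + 2 by ring] at this
  refine le_sqrt_mul_sqrt_of_forall (srwI_zero_even_nonneg n j) hB fun lam hl => ?_
  -- majorant `|t|^{2j+1} ≤ (λ t^{2j} + t^{2j+2}/λ)/2`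
  classical
  let p : ℕ → ℝ := fun i => if i = 2 * j then lam / 2 else if i = 2 * j + 2 then 1 / (2 * lam) else 0
  have hmaj : ∀ t ∈ Set.Icc (-1 : ℝ) 1,
      |t| ^ (2 * j + 1) ≤ ∑ i ∈ Finset.range (2 * j + 2 + 1), p i * t ^ i := by
    intro t _
    have hne : 2 * j + 2 ≠ 2 * j := by omega
    have hs : ∑ i ∈ Finset.range (2 * j + 2 + 1), p i * t ^ i =
        lam / 2 * t ^ (2 * j) + 1 / (2 * lam) * t ^ (2 * j + 2) := by
      rw [Finset.sum_eq_add_of_mem (2 * j) (2 * j + 2) (by simp) (by simp) (by omega)]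
      · simp [p]
      · intro i _ hi
        simp [p, hi.1, hi.2]
    rw [hs]
    have h := abs_mul_abs_le_am_gm (t ^ j) (t ^ (j + 1)) hl
    have e1 : |t| ^ (2 * j + 1) = |t ^ j| * |t ^ (j + 1)| := by
      rw [abs_pow, abs_pow, ← pow_add]; ring_nf
    rw [e1]
    refine h.trans (le_of_eq ?_)
    ring
  refine (srwK_zero_le_of_majorant hd (2 * j + 1) (2 * j + 2) p hmaj).trans (le_of_eq ?_)
  have hne : 2 * j + 2 ≠ 2 * j := by omega
  rw [Finset.sum_eq_add_of_mem (2 * j) (2 * j + 2) (by simp) (by simp) (by omega)]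
  · simp [p]
    ring
  · intro i _ hi
    simp [p, hi.1, hi.2]

/-! ### Cauchy–Schwarz against `L_n(x)` ((5.9)) and the recursion (5.15) -/

/-- (5.9) / [HS92b] (B.25)–(B.27): `K_{n,l}(x) ≤ [I_{n,2l}(0) L_n(x)]^{1/2}` (`d ≥ 2n + 1`).
[cite: FitznerVanDerHofstad2016NoBLE, (5.9) p. 1091] -/
theorem srwK_le_sqrt_srwI_mul_srwL {n : ℕ} (hd : 2 * n + 1 ≤ d) (l : ℕ) (x : Fin d → ℤ) :
    srwK d n l x ≤ Real.sqrt (srwI d n (2 * l) 0) * Real.sqrt (srwL d n x) := by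
  refine le_sqrt_mul_sqrt_of_forall (srwI_zero_even_nonneg n l) (srwL_nonneg n x)
    fun lam hl => ?_
  have hA := integrable_srwI_integrand hd (2 * l) (0 : Fin d → ℤ)
  have hB := integrable_srwL_integrand hd x (n := n)
  have key : ∫ k, (|Dhat d k| ^ l * |DhatSym d x k|) * Chat d 1 k ^ n ∂P d ≤
      ∫ k, (lam * ((Dhat d k ^ (2 * l) * DhatSym d 0 k) * Chat d 1 k ^ n) +
        lam⁻¹ * (DhatSym d x k ^ 2 * Chat d 1 k ^ n)) / 2 ∂P d := by
    refine integral_mono_of_nonneg (ae_of_all _ fun k => ?_)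
      (((hA.const_mul lam).add (hB.const_mul lam⁻¹)).div_const 2) (ae_of_all _ fun k => ?_)
    · exact mul_nonneg (mul_nonneg (pow_nonneg (abs_nonneg _) l) (abs_nonneg _))
        (pow_nonneg (Chat_one_nonneg k) n)
    · have h := abs_mul_abs_le_am_gm (Dhat d k ^ l) (DhatSym d x k) hl
      have hC := pow_nonneg (Chat_one_nonneg k) n
      have h2 := mul_le_mul_of_nonneg_right h hC
      rw [abs_pow] at h2
      refine h2.trans (le_of_eq ?_)
      simp only [DhatSym_zero]
      ring
  have e : ∫ k, (lam * ((Dhat d k ^ (2 * l) * DhatSym d 0 k) * Chat d 1 k ^ n) +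
        lam⁻¹ * (DhatSym d x k ^ 2 * Chat d 1 k ^ n)) / 2 ∂P d =
      (lam * (∫ k, (Dhat d k ^ (2 * l) * DhatSym d 0 k) * Chat d 1 k ^ n ∂P d) +
        lam⁻¹ * ∫ k, DhatSym d x k ^ 2 * Chat d 1 k ^ n ∂P d) / 2 := by
    rw [integral_div, integral_add (hA.const_mul lam) (hB.const_mul lam⁻¹), integral_const_mul,
      integral_const_mul]
  unfold srwK srwI srwL
  calc (∫ k, (|Dhat d k| ^ l * |DhatSym d x k|) * Chat d 1 k ^ n ∂P d) / (2 * π) ^ d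
      ≤ ((lam * (∫ k, (Dhat d k ^ (2 * l) * DhatSym d 0 k) * Chat d 1 k ^ n ∂P d) +
          lam⁻¹ * ∫ k, DhatSym d x k ^ 2 * Chat d 1 k ^ n ∂P d) / 2) / (2 * π) ^ d :=
        div_le_div_of_nonneg_right (key.trans_eq e) (two_pi_pow_pos d).le
    _ = _ := by ring

/-- The pointwise form of (5.15): for `n ≥ 1`,
`Ĉⁿ ≤ Ĉⁿ⁻¹ + |D̂| Ĉⁿ⁻¹ + D̂² Ĉⁿ` (an identity off the point `D̂ = 1`, where Lean's `Ĉ = 0`).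
[cite: FitznerVanDerHofstad2016NoBLE, (5.15) p. 1092] -/
theorem Chat_pow_le_three_terms (n : ℕ) (k : Fin d → ℝ) :
    Chat d 1 k ^ (n + 1) ≤
      Chat d 1 k ^ n + |Dhat d k| * Chat d 1 k ^ n + Dhat d k ^ 2 * Chat d 1 k ^ (n + 1) := by
  have hC := Chat_one_nonneg k
  rcases eq_or_ne (Dhat d k) 1 with h1 | h1
  · -- `D̂ = 1`: `Ĉ = 1/0 = 0`
    have : Chat d 1 k = 0 := by rw [Chat, h1]; simp
    rw [this]
    rcases Nat.eq_zero_or_pos n with rfl | hn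
    · simp; positivity
    · simp [zero_pow hn.ne', zero_pow (Nat.succ_ne_zero n)]
  · have hX : 0 < 1 - Dhat d k := lt_of_le_of_ne (one_sub_Dhat_nonneg k) (by
      intro h; exact h1 (by linarith))
    have hCdef : Chat d 1 k = 1 / (1 - Dhat d k) := by rw [Chat, one_mul]
    have hu : Chat d 1 k * (1 - Dhat d k) = 1 := by
      rw [hCdef]; field_simp
    -- identity: Ĉ^{n+1} = Ĉⁿ + D̂ Ĉⁿ + D̂² Ĉ^{n+1}, from Ĉ(1 - D̂) = 1
    have hid : Chat d 1 k ^ (n + 1) =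
        Chat d 1 k ^ n + Dhat d k * Chat d 1 k ^ n + Dhat d k ^ 2 * Chat d 1 k ^ (n + 1) := by
      linear_combination (Chat d 1 k ^ n * (1 + Dhat d k)) * hu
    have hle : Dhat d k * Chat d 1 k ^ n ≤ |Dhat d k| * Chat d 1 k ^ n :=
      mul_le_mul_of_nonneg_right (le_abs_self _) (pow_nonneg hC n)
    linarith

/-- Consequence of (5.15): `K_{n+1,l}(x) ≤ K_{n,l}(x) + K_{n,l+1}(x) + K_{n+1,l+2}(x)`
(`d ≥ 2n + 3`). [cite: FitznerVanDerHofstad2016NoBLE, (5.15)–(5.16) p. 1092] -/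
theorem srwK_le_three_terms {n : ℕ} (hd : 2 * (n + 1) + 1 ≤ d) (l : ℕ) (x : Fin d → ℤ) :
    srwK d (n + 1) l x ≤ srwK d n l x + srwK d n (l + 1) x + srwK d (n + 1) (l + 2) x := by
  have hd' : 2 * n + 1 ≤ d := by omega
  have h1 := integrable_srwK_integrand hd' l x
  have h2 := integrable_srwK_integrand hd' (l + 1) x
  have h3 := integrable_srwK_integrand hd (l + 2) x
  have h12 : Integrable (fun k => (|Dhat d k| ^ l * |DhatSym d x k|) * Chat d 1 k ^ n +
      (|Dhat d k| ^ (l + 1) * |DhatSym d x k|) * Chat d 1 k ^ n) (P d) := h1.add h2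
  have h123 : Integrable (fun k => (|Dhat d k| ^ l * |DhatSym d x k|) * Chat d 1 k ^ n +
      (|Dhat d k| ^ (l + 1) * |DhatSym d x k|) * Chat d 1 k ^ n +
      (|Dhat d k| ^ (l + 2) * |DhatSym d x k|) * Chat d 1 k ^ (n + 1)) (P d) := h12.add h3
  unfold srwK
  rw [← add_div, ← add_div, ← integral_add h1 h2, ← integral_add h12 h3]
  refine div_le_div_of_nonneg_right ?_ (two_pi_pow_pos d).le
  refine integral_mono_of_nonneg (ae_of_all _ fun k => ?_) h123 (ae_of_all _ fun k => ?_)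
  · exact mul_nonneg (mul_nonneg (pow_nonneg (abs_nonneg _) l) (abs_nonneg _))
      (pow_nonneg (Chat_one_nonneg k) (n + 1))
  · have h := Chat_pow_le_three_terms n k
    have hw : 0 ≤ |Dhat d k| ^ l * |DhatSym d x k| :=
      mul_nonneg (pow_nonneg (abs_nonneg _) l) (abs_nonneg _)
    have e : (|Dhat d k| ^ l * |DhatSym d x k|) * Chat d 1 k ^ n +
        (|Dhat d k| ^ (l + 1) * |DhatSym d x k|) * Chat d 1 k ^ n +
        (|Dhat d k| ^ (l + 2) * |DhatSym d x k|) * Chat d 1 k ^ (n + 1) =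
        (|Dhat d k| ^ l * |DhatSym d x k|) * (Chat d 1 k ^ n + |Dhat d k| * Chat d 1 k ^ n +
          Dhat d k ^ 2 * Chat d 1 k ^ (n + 1)) := by
      rw [← sq_abs (Dhat d k)]; ring
    show (|Dhat d k| ^ l * |DhatSym d x k|) * Chat d 1 k ^ (n + 1) ≤
      (|Dhat d k| ^ l * |DhatSym d x k|) * Chat d 1 k ^ n +
        (|Dhat d k| ^ (l + 1) * |DhatSym d x k|) * Chat d 1 k ^ n +
        (|Dhat d k| ^ (l + 2) * |DhatSym d x k|) * Chat d 1 k ^ (n + 1)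
    rw [e]
    exact mul_le_mul_of_nonneg_left h hw

/-! ### The valid bounds at `x = e_i`, packaged -/

/-- `l` odd: `K_{n,l}(e_i) = K_{n,l+1}(0) = I_{n,l+1}(0)` exactly.
[cite: FitznerVanDerHofstad2016NoBLE, (3.34)–(3.36) p. 1071, (5.14) p. 1092] -/
theorem srwK_single_odd (n j : ℕ) (i : Fin d) :
    srwK d n (2 * j + 1) (Pi.single i 1) = srwI d n (2 * j + 2) 0 := by
  rw [srwK_single, show 2 * j + 1 + 1 = 2 * (j + 1) by ring, srwK_zero_even]

/-- `l` even — the VALID replacement of `SRW.nb`'s `Abs[Ivalue[n, l+1, {0}]]`: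
`K_{n,2j}(e_i) = K_{n,2j+1}(0) ≤ [I_{n,2j}(0) I_{n,2j+2}(0)]^{1/2}` (`d ≥ 2n + 1`).
[cite: FitznerVanDerHofstad2016NoBLE, (3.34)–(3.36) p. 1071, (5.14) p. 1092] -/
theorem srwK_single_even_le {n : ℕ} (hd : 2 * n + 1 ≤ d) (j : ℕ) (i : Fin d) :
    srwK d n (2 * j) (Pi.single i 1) ≤
      Real.sqrt (srwI d n (2 * j) 0) * Real.sqrt (srwI d n (2 * j + 2) 0) := by
  rw [srwK_single]
  exact srwK_zero_odd_le hd j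

/-- `l` even, sharper: for any polynomial majorant `|t|^{2j+1} ≤ Σ_{i ≤ N} p_i t^i` on `[-1,1]`,
`K_{n,2j}(e_i) ≤ Σ_i p_i I_{n,i}(0)` (`d ≥ 2n + 1`). [folklore] -/
theorem srwK_single_le_of_majorant {n : ℕ} (hd : 2 * n + 1 ≤ d) (l : ℕ) (i : Fin d) (N : ℕ)
    (p : ℕ → ℝ)
    (hP : ∀ t ∈ Set.Icc (-1 : ℝ) 1, |t| ^ (l + 1) ≤ ∑ j ∈ Finset.range (N + 1), p j * t ^ j) :
    srwK d n l (Pi.single i 1) ≤ ∑ j ∈ Finset.range (N + 1), p j * srwI d n j 0 := by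
  rw [srwK_single]
  exact srwK_zero_le_of_majorant hd (l + 1) N p hP

/-- Monotonised use at `x = e_i`: for `l ≤ l'`, `K_{n,l'}(e_i) ≤ K_{n,l}(e_i)`, so any of the
bounds above for a smaller (even or odd) `l` is a valid bound for `K_{n,l'}(e_i)`. [folklore] -/
theorem srwK_single_anti {n : ℕ} (hd : 2 * n + 1 ≤ d) (i : Fin d) {l l' : ℕ} (h : l ≤ l') :
    srwK d n l' (Pi.single i 1) ≤ srwK d n l (Pi.single i 1) :=
  srwK_anti hd _ h

end Literature.Probability.FitznerVanDerHofstad2017
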